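import Summits.BirchSwinnertonDyer.BirchSwinnertonDyer.Theorems.GenusKolyvaginAtTwoPowDvdShaCardAtTwoRTLocalKernelLowerBound
import Summits.BirchSwinnertonDyer.BirchSwinnertonDyer.Theorems.GenusKolyvaginAtTwoGenusPrimitiveSupplyAtTwoTwistRamifiedTransversalRat
import Summits.BirchSwinnertonDyer.BirchSwinnertonDyer.Theorems.GenusKolyvaginAtTwoGenusPrimitiveSupplyAtTwoTwistRamifiedTorsion
import HarnessLib

/-!
# Route `GenusKolyvaginAtTwo`, LINE 18 / LINE 19 (L_T stmt-BirchSwinnertonDyer-23242, L⁺_T stmt-23379) — KRAMER 1981 PROP. 3 IN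
# FULL at a ramified good odd place: `#W_{v,K} = #E(ℚ_v)[2]` (2/2, the local application)

Seat `bsd-line-gk2-p3` g20 (cell `bsd-f1-sign2`), `--supports stmt-BirchSwinnertonDyer-23242` (helper; closes nothing).
THEOREMS ONLY (no definition, no named fact, no `sorry`); BSD is not proved by any of this.

WHAT.  Sequel of `…RTLocalKernelLowerBound` (1/2: the inflated classes of the rational `2`-torsion inject into the kernel of
restriction along a quadratic extension, given ONE element outside `Γ_L` fixing the `2^k`-torsion).  Here the local discharge:
for `E/ℚ` elliptic with good reduction at `v ∤ 2`, `K` a number field containing `θ` with `θ² = d`, `v(d) = 1` and a place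
`w ∣ v` with `[K_w : ℚ_v] = 2`, the element is an INERTIA element `τ₀ ∈ I_{ℚ_v}` with `τ₀ √d = −√d`
(`GenusKolyTwistLocal.exists_mem_absInertia_smul_eq_neg` + `GenusKolyTwistRamified.closureEmb_geomSqrt_not_mem_maxUnramified_rat`):
it lies outside `Γ_{K_w}` (whose elements fix `±√d ∈ K_w`) and fixes `E(ℚ̄_v)[2^k]` (good reduction at `v ∤ 2`,
`GenusKolyTwistLocal.smul_eq_self_of_mem_absInertia_of_zsmul_eq_zero`).  Results:
**`natCard_twoTorsion_le_natCard_localKernel`** (`#E(ℚ_v)[2] ≤ #W_{v,K}`, the LOWER half of Kramer 1981 Prop. 3) and, with the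
seat's g17 upper half `natCard_localKernel_le_natCard_twoTorsion`, **`natCard_localKernel_eq_natCard_twoTorsion`**:
`#W_{v,K} = #E(ℚ_v)[2] = #Ẽ(𝔽_p)[2] = 2^{i_p}` EXACTLY — at level `2` the `d_K`-relaxation «`K`-trivial at `p ∣ d_K`» of LINE 18/19
is «no condition at `p`», and the relaxed group `res⁻¹Ш(E_K)` contains Kramer's genus classes (memo
`Cruxes/PowDvdShaCardAtTwoRT/Lines/plus-descent-stubJ-audit.md` §2, the local input of the stub-J audit).

References: [Kramer1981] §2 Prop. 3, §4 (11)–(13); [MazurRubin2010] Lemma 2.11; [Matsuno2009] §3, Lemma 4.2;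
[SilvermanAEC2009] VII.4.1, VII.6.3; [SerreLocalFields1979] IV §1.
-/

set_option autoImplicit false
-- the Theorems namespace of this sub repeats the summit name by design (D-0017 nested layout)
set_option linter.dupNamespace false

noncomputable section

open scoped Classical

namespace Summit.BirchSwinnertonDyer.BirchSwinnertonDyer.Theorems.GenusExact.PlusDescent

open WeierstrassCurve Literature.NumberTheory.EllipticCurves Literature.NumberTheory.GaloisRepresentations
  Literature.Barriers.BirchSwinnertonDyer

universe u

/-! ## §3 `#W_{v,K} = #E(ℚ_v)[2]` at a ramified good odd place -/

section Local

open NumberField IsDedekindDomain Literature.NumberTheory.GaloisRepresentations.IsNonarchimedeanLocalField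

/-- **KRAMER 1981 PROP. 3, LOWER HALF: `#E(ℚ_v)[2] ≤ #W_{v,K}`** at a place `w ∣ v` of a number field `K ∋ θ`, `θ² = d`, with
`v(d) = 1` (so `K_w ⊇ ℚ_v(√d)` is RAMIFIED over `ℚ_v`), `[K_w : ℚ_v] = 2`, `v ∤ 2`, `E/ℚ` with good reduction at `v`: every
`T ∈ E(ℚ_v)[2]` gives a distinct class of Matsuno's `W_{v,K} = ker(H¹(ℚ_v, E) → H¹(K_w, E))`.  Proof: §2 for `F = ℚ_v`,
`L = K_w`, the g17 divisibility datum `k` (Silverman VII.6.3 / Milne I.3.3, exactly as in `natCard_localKernel_le_natCard_twoTorsion`),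
and `σ = τ₀` an INERTIA element with `τ₀ √d = −√d` (`exists_mem_absInertia_smul_eq_neg`, `closureEmb_geomSqrt_not_mem_maxUnramified_rat`):
`τ₀ ∉ Γ_{K_w}` (every element of `Γ_{K_w}` fixes `±√d ∈ K_w`) and `τ₀` fixes `E(ℚ̄_v)[2^k]` (good reduction at `v ∤ 2`,
`smul_eq_self_of_mem_absInertia_of_zsmul_eq_zero`). [cite: Kramer1981, §2 Prop. 3] [cite: SilvermanAEC2009, VII.4.1 and VII.6.3]
[cite: SerreLocalFields1979, IV §1] -/
theorem natCard_twoTorsion_le_natCard_localKernel (E : WeierstrassCurve ℚ) [E.IsElliptic]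
    (K : Type) [Field K] [NumberField K] (v : HeightOneSpectrum (𝓞 ℚ)) (w : HeightOneSpectrum (𝓞 K))
    [w.asIdeal.LiesOver v.asIdeal]
    (h2 : letI : Algebra (v.adicCompletion ℚ) (w.adicCompletion K) :=
        (Literature.NumberTheory.EllipticCurves.adicCompletionMap (K := ℚ) K v w).toAlgebra
      Module.finrank (v.adicCompletion ℚ) (w.adicCompletion K) = 2)
    (hw : ((2 : ℕ) : 𝓞 K) ∉ w.asIdeal) (hv2 : ((2 : ℕ) : 𝓞 ℚ) ∉ v.asIdeal) (hgood : E.HasGoodReductionAt v)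
    {d : ℚ} (hdv : v.valuation ℚ d = WithZero.exp (-1 : ℤ)) (θ : K) (hθ : θ ^ 2 = algebraMap ℚ K d) :
    Nat.card {P : (E.baseChange (v.adicCompletion ℚ)).toAffine.Point // 2 • P = 0} ≤
      Nat.card (Matsuno2009.localKernel E K v w) := by
  -- pin the `ℚ`-algebra structure of `ℚ_v` to the one inside `Matsuno2009.localKernel`
  letI instQv : Algebra ℚ (v.adicCompletion ℚ) :=
    IsDedekindDomain.HeightOneSpectrum.instAlgebraAdicCompletion (𝓞 ℚ) ℚ v
  letI : Algebra (v.adicCompletion ℚ) (w.adicCompletion K) :=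
    (Literature.NumberTheory.EllipticCurves.adicCompletionMap (K := ℚ) K v w).toAlgebra
  haveI : IsScalarTower ℚ (v.adicCompletion ℚ) (w.adicCompletion K) := IsScalarTower.rat
  haveI : IsScalarTower ℚ K (w.adicCompletion K) := IsScalarTower.rat
  haveI : CharZero (v.adicCompletion ℚ) :=
    charZero_of_injective_algebraMap (algebraMap ℚ (v.adicCompletion ℚ)).injective
  haveI : FiniteDimensional (v.adicCompletion ℚ) (w.adicCompletion K) :=
    Module.finite_of_finrank_eq_succ h2
  haveI hEK : (E.baseChange K).IsElliptic := by rw [WeierstrassCurve.baseChange]; infer_instance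
  set F := v.adicCompletion ℚ with hFdef
  -- the models `(E_K)_{K_w}` and `(E_{ℚ_v})_{K_w}` of `E(K_w)`
  let c : ((E.baseChange K).baseChange (w.adicCompletion K)).toAffine.Point ≃+
      ((E.baseChange F).baseChange (w.adicCompletion K)).toAffine.Point :=
    (pointsCongr E K (w.adicCompletion K)).symm.trans (pointsCongr E F (w.adicCompletion K))
  -- Silverman VII.6.3 / Milne I.3.3: a finite-index torsion-free `U ≤ E(K_w)` with `[U : 2U] = #(𝒪_w/2) = 1`
  obtain ⟨U, hU, htf, hidx⟩ := Literature.NumberTheory.EllipticCurves.LocalPoints.transfer c.symm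
    ((E.baseChange K).exists_finiteIndex_torsionFree_adicCompletion w)
  haveI := hU
  have hunit : IsUnit ((2 : ℕ) : w.adicCompletionIntegers K) := by
    rw [LocalPoints.isUnit_iff_valuation_eq_one]
    have h := LocalPoints.valuation_natCast_eq_one w hw
    exact_mod_cast h
  have hq1 : Nat.card (w.adicCompletionIntegers K ⧸ Ideal.span {((2 : ℕ) : w.adicCompletionIntegers K)}) = 1 := by
    rw [Ideal.span_singleton_eq_top.mpr hunit]
    exact Nat.card_unique
  have hUdiv : ∀ u ∈ U, ∃ u' ∈ U, u = 2 • u' := by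
    have h1 : (U.map (nsmulAddMonoidHom 2 : _ →+ _)).relIndex U = 1 := by rw [hidx 2 two_ne_zero, hq1]
    intro u hu
    obtain ⟨u', hu', hu'u⟩ := AddSubgroup.relIndex_eq_one.mp h1 hu
    exact ⟨u', hu', hu'u.symm⟩
  obtain ⟨k, hk2, hkdiv, -⟩ :=
    exists_pow_nsmul_uniquely_two_divisible U (fun u hu h ↦ htf 2 two_ne_zero u hu h) hUdiv
  -- the inertia element `τ₀` negating `√d`
  letI instQbar : Algebra ℚ (AlgebraicClosure F) := AlgebraicClosure.instAlgebra F
  haveI : CharZero (AlgebraicClosure F) :=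
    charZero_of_injective_algebraMap (algebraMap F (AlgebraicClosure F)).injective
  set x : AlgebraicClosure F := closureEmb (K := ℚ) F (geomSqrt d) with hxdef
  have hx : x ∉ maxUnramified F := GenusKolyTwistRamified.closureEmb_geomSqrt_not_mem_maxUnramified_rat v hdv
  have hx2 : x ^ 2 = algebraMap ℚ (AlgebraicClosure F) d := by
    rw [hxdef, ← map_pow, geomSqrt_sq, AlgHom.commutes]
  have hxF : x ^ 2 = algebraMap F (AlgebraicClosure F) (algebraMap ℚ F d) := by
    rw [hx2, IsScalarTower.algebraMap_apply ℚ F (AlgebraicClosure F)]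
  obtain ⟨τ₀, hτ₀I, hτ₀x⟩ := GenusKolyTwistLocal.exists_mem_absInertia_smul_eq_neg (K := ℚ) v hx2 hx
  have hd0 : d ≠ 0 := by
    intro h
    rw [h, map_zero] at hdv
    exact WithZero.zero_ne_coe hdv
  have hx0 : x ≠ 0 := by
    intro h
    rw [h, zero_pow two_ne_zero, eq_comm, map_eq_zero, map_eq_zero] at hxF
    exact hd0 hxF
  -- `τ₀ ∉ Γ_{K_w}`: every element of `Γ_{K_w}` fixes `ι'(x) = ±√d ∈ K_w`
  have hτ₀N : τ₀ ∉ galRange (K := F) (w.adicCompletion K) := by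
    intro hmem
    obtain ⟨γ, hγ⟩ := (mem_galRange_iff (w.adicCompletion K) τ₀).mp hmem
    set ι' : AlgebraicClosure F →ₐ[F] AlgebraicClosure (w.adicCompletion K) :=
      closureEmb (K := F) (w.adicCompletion K) with hι'
    have hcomm : ι' ((show AlgebraicClosure F ≃ₐ[F] AlgebraicClosure F from τ₀) x) =
        (show AlgebraicClosure (w.adicCompletion K) ≃ₐ[w.adicCompletion K] AlgebraicClosure (w.adicCompletion K)
          from γ) (ι' x) := by
      rw [← hγ]
      exact apply_resGalAuxOfEmb_apply ι' γ x
    -- `ι' x = ± √d` with `√d ∈ K_w`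
    set cw : AlgebraicClosure (w.adicCompletion K) :=
      algebraMap (w.adicCompletion K) (AlgebraicClosure (w.adicCompletion K)) (algebraMap K (w.adicCompletion K) θ)
      with hcwdef
    have hR : (ι' x) ^ 2 = algebraMap (w.adicCompletion K) (AlgebraicClosure (w.adicCompletion K))
        (algebraMap ℚ (w.adicCompletion K) d) := by
      rw [← map_pow, hxF, AlgHom.commutes,
        IsScalarTower.algebraMap_apply F (w.adicCompletion K) (AlgebraicClosure (w.adicCompletion K))
          (algebraMap ℚ F d),
        ← IsScalarTower.algebraMap_apply ℚ F (w.adicCompletion K) d]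
    have hL : cw ^ 2 = algebraMap (w.adicCompletion K) (AlgebraicClosure (w.adicCompletion K))
        (algebraMap ℚ (w.adicCompletion K) d) := by
      rw [hcwdef, ← map_pow, ← map_pow, hθ, ← IsScalarTower.algebraMap_apply ℚ K (w.adicCompletion K) d]
    have hcw2 : cw ^ 2 = (ι' x) ^ 2 := hL.trans hR.symm
    have hγcw : (show AlgebraicClosure (w.adicCompletion K) ≃ₐ[w.adicCompletion K] AlgebraicClosure (w.adicCompletion K)
          from γ) cw = cw := AlgEquiv.commutes _ _
    have hγfix : (show AlgebraicClosure (w.adicCompletion K) ≃ₐ[w.adicCompletion K] AlgebraicClosure (w.adicCompletion K)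
          from γ) (ι' x) = ι' x := by
      rcases sq_eq_sq_iff_eq_or_eq_neg.mp hcw2.symm with h | h
      · rw [h, hγcw]
      · rw [h, map_neg, hγcw]
    rw [hγfix] at hcomm
    have hτx : (show AlgebraicClosure F ≃ₐ[F] AlgebraicClosure F from τ₀) x = x := ι'.injective hcomm
    have hneg : x = -x := by
      have h := hτ₀x
      change (show AlgebraicClosure F ≃ₐ[F] AlgebraicClosure F from τ₀) x = -x at h
      exact hτx.symm.trans h
    rw [eq_neg_iff_add_eq_zero, ← two_mul, mul_eq_zero] at hneg
    rcases hneg with h | h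
    · exact two_ne_zero h
    · exact hx0 h
  -- `τ₀` fixes the `2^k`-torsion of `E(ℚ̄_v)` (good reduction at `v ∤ 2`)
  have hσ : ∃ σ : Field.absoluteGaloisGroup F, σ ∉ galRange (K := F) (w.adicCompletion K) ∧
      ∀ u : geomPoints (E.baseChange F), (∀ n ∈ galRange (K := F) (w.adicCompletion K), n • u = u) →
        2 ^ k • u = 0 → σ • u = u := by
    refine ⟨τ₀, hτ₀N, fun u _ hu ↦ ?_⟩
    set eqv := localPointsEquivGeomPoints E F with heqv
    obtain ⟨R, rfl⟩ := eqv.surjective u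
    have hR : ((2 ^ k : ℕ) : ℤ) • R = 0 := by
      rw [natCast_zsmul]
      apply eqv.injective
      rw [map_nsmul, hu, map_zero]
    rw [← localPointsEquivGeomPoints_smul,
      GenusKolyTwistLocal.smul_eq_self_of_mem_absInertia_of_zsmul_eq_zero E v hgood hv2 k hτ₀I hR]
  -- §2 in the model `(E_{ℚ_v})_{ℚ_v}`, then back to `Matsuno2009.localKernel`
  obtain ⟨ι, hι⟩ := exists_injective_twoTorsion_localRestrictionKer_of_finrank_eq_two (E.baseChange F)
    (w.adicCompletion K) h2 k hk2 hkdiv hσ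
  let c₀ : (E.baseChange F).toAffine.Point ≃+ ((E.baseChange F).baseChange F).toAffine.Point := pointsCongr E F F
  let e₀ : {P : (E.baseChange F).toAffine.Point // 2 • P = 0} ≃
      {P : ((E.baseChange F).baseChange F).toAffine.Point // 2 • P = 0} :=
    c₀.toEquiv.subtypeEquiv fun P ↦ by
      change 2 • P = 0 ↔ 2 • c₀ P = 0
      rw [← map_nsmul, map_eq_zero_iff c₀ c₀.injective]
  obtain ⟨hfinK, -⟩ := natCard_localKernel_le_natCard_twoTorsion E K v w h2 hw
  haveI : Finite ((E.baseChange F).localRestrictionKer (w.adicCompletion K)) := by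
    unfold Matsuno2009.localKernel at hfinK
    exact hfinK
  rw [Nat.card_congr e₀]
  unfold Matsuno2009.localKernel
  exact Nat.card_le_card_of_injective ι hι

/-- **KRAMER 1981 PROP. 3 IN FULL at a ramified good odd place: `#W_{v,K} = #E(ℚ_v)[2]`** (`= #Ẽ(𝔽_p)[2] = 2^{i_p}`): the seat's g17
upper half `natCard_localKernel_le_natCard_twoTorsion` and the lower half above.  So at such a place the local kernel of
`H¹(ℚ_v, E) → H¹(K_w, E)` has EXACTLY the order of `E(ℚ_v)[2]`: the `d_K`-relaxation of LINE 18/19 costs the full `i_p` bits, and the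
relaxed group `res⁻¹Ш(E_K)` contains the genus classes of memo `Lines/plus-descent-stubJ-audit.md` §2.
[cite: Kramer1981, §2 Prop. 3] [cite: Matsuno2009, §3 and Lemma 4.2] -/
theorem natCard_localKernel_eq_natCard_twoTorsion (E : WeierstrassCurve ℚ) [E.IsElliptic]
    (K : Type) [Field K] [NumberField K] (v : HeightOneSpectrum (𝓞 ℚ)) (w : HeightOneSpectrum (𝓞 K))
    [w.asIdeal.LiesOver v.asIdeal]
    (h2 : letI : Algebra (v.adicCompletion ℚ) (w.adicCompletion K) :=
        (Literature.NumberTheory.EllipticCurves.adicCompletionMap (K := ℚ) K v w).toAlgebra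
      Module.finrank (v.adicCompletion ℚ) (w.adicCompletion K) = 2)
    (hw : ((2 : ℕ) : 𝓞 K) ∉ w.asIdeal) (hv2 : ((2 : ℕ) : 𝓞 ℚ) ∉ v.asIdeal) (hgood : E.HasGoodReductionAt v)
    {d : ℚ} (hdv : v.valuation ℚ d = WithZero.exp (-1 : ℤ)) (θ : K) (hθ : θ ^ 2 = algebraMap ℚ K d) :
    Nat.card (Matsuno2009.localKernel E K v w) =
      Nat.card {P : (E.baseChange (v.adicCompletion ℚ)).toAffine.Point // 2 • P = 0} :=
  le_antisymm (natCard_localKernel_le_natCard_twoTorsion E K v w h2 hw).2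
    (natCard_twoTorsion_le_natCard_localKernel E K v w h2 hw hv2 hgood hdv θ hθ)

end Local

end Summit.BirchSwinnertonDyer.BirchSwinnertonDyer.Theorems.GenusExact.PlusDescent

end
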